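import Summits.Ventures.PercRepro.Night2TraceFacts
import Summits.Ventures.PercRepro.RankLevelSetPlaneSix
import Summits.Ventures.PercRepro.Night2TrT2C2Q4M0Z
import Summits.Ventures.PercRepro.Night2TrT2C3Q4M0Z
import Summits.Ventures.PercRepro.Night2TrT2C4Q4M0Z
import Summits.Ventures.PercRepro.Night2TrT2C5Q4M0Z
import Summits.Ventures.PercRepro.Night2TrT2C6Q4M0Z
import Summits.Ventures.PercRepro.Night2TrT2C2Q4M1Z
import Summits.Ventures.PercRepro.Night2TrT2C3Q4M1Z
import Summits.Ventures.PercRepro.Night2TrT3C3Q4M0Z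
import Summits.Ventures.PercRepro.Night2TrT3C4Q4M0Z
import Summits.Ventures.PercRepro.Night2TrT3C5Q4M0Z
import Summits.Ventures.PercRepro.Night2TrT3C6Q4M0Z
import Summits.Ventures.PercRepro.Night2TrT3C3Q4M1Z
import Summits.Ventures.PercRepro.Night2TrT4C4Q4M0Z
import Summits.Ventures.PercRepro.Night2TrT4C5Q4M0Z
import Summits.Ventures.PercRepro.Night2TrT4C6Q4M0Z

/-!
# PercRepro — `SevenFiveTraceSumsCore` FROM THE CERTIFICATES: the trace sums of `(7, 5)` at `t = 2, 3, 4` on every rank-`4`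
subset of a rank-`7` Core matroid, from `f(4) ≤ 10` (night-2, gen 4)

A rank-`4` subset `H` of the core has `≤ 10` points (`card_le_ten_of_eRk_eq_four_of_ten`, through `cl(H)` and the
rank-`4` bound `f(4) ≤ 10`), and by its coloop count `m(H)`: `≤ 7` points at `m = 1` (a coloop and a `≤ 6`-point plane
part), `≤ 5` at `m = 2`, `≤ 4` at `m = 3`, `≤ 5` at `m = 4` (`card_le_of_mTr`; lines `≤ 3` points on the core,
planes `≤ 6` by night-1's `ncard_le_six_of_eRk_le_three_of_free`).  At corank `≤ t − 1` every set is demand-free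
(`traceSum_nonneg_of_card_le`); the remaining `15` cases `(t, m(H), corank)` are the dual certificates
`traceSum_nonneg_t{t}_c{d}_q4_m{m}` of the trace profile LP on the core (`mining/night-2/g4/`, `TRACE`).
**`sevenFiveTraceSumsCore_of_ten : (f(4) ≤ 10 on every Core matroid) → SevenFiveTraceSumsCore`** replaces night-4's
two-seat census of corner (i)'s world by a kernel proof.  Imports `Night2TraceFacts`, `RankLevelSetPlaneSix` and the
`15` certificate modules.
-/
namespace PercRepro.Star

open Finset ThmH SixFour GenQ PerFlat ThmN NightThree

/-- **`SevenFiveTraceSumsCore` from `f(4) ≤ 10`**: the `(7, 5)` trace sums at `t = 2, 3, 4` on every rank-`4` subset of a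
rank-`7` Core matroid. -/
theorem sevenFiveTraceSumsCore_of_ten
    (h10 : ∀ {β : Type} [DecidableEq β] (M : Matroid β) [M.Finite] {p : ℕ}, Core M p →
      ∀ F ∈ flatsQ M 4, F.card ≤ 10) : SevenFiveTraceSumsCore := by
  intro β _ M _ H hc hH hr t ht2 ht4
  have hs : Simple M := simple_of_core hc
  have hline : ∀ L ∈ flatsQ M 2, L.card ≤ 3 := fun L hL => card_le_three_of_line_of_core hc hL
  have hplane : ∀ P ∈ flatsQ M 3, P.card ≤ 6 := by
    intro P hP
    have hP' := mem_flatsQ.1 hP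
    have hPE : (P : Set β) ⊆ M.E := by
      rw [← coe_gr M]
      exact Finset.coe_subset.2 hP'.1
    have hr3 : M.eRk (P : Set β) ≤ 3 := by
      rw [hP'.2.2]
      rfl
    have h := ncard_le_six_of_eRk_le_three_of_free M hc.2.2.2 hPE hr3
    rwa [Set.ncard_coe_finset] at h
  have h10' := card_le_ten_of_eRk_eq_four_of_ten (h10 M hc) hH hr
  have hsz := card_le_of_mTr hs hline hplane hH hr
  have h4 : 4 ≤ H.card := le_card_of_eRk_eq hr
  have hmle : mTr M H ≤ 4 := mTr_le_of_eRk_eq hH hr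
  interval_cases t
  · -- `t = 2`
    rcases (show mTr M H = 0 ∨ mTr M H = 1 ∨ mTr M H = 2 ∨ mTr M H = 3 ∨ mTr M H = 4 by omega) with hm | hm | hm | hm | hm
    · rcases (show H.card ≤ 5 ∨ H.card = 6 ∨ H.card = 7 ∨ H.card = 8 ∨ H.card = 9 ∨ H.card = 10 by omega) with h0 | h1 | h2 | h3 | h4 | h5
      · exact traceSum_nonneg_of_card_le (by norm_num) (by norm_num) (by omega)
      · exact traceSum_nonneg_t2_c2_q4_m0 hs hline hplane hH hr (by omega) hm
      · exact traceSum_nonneg_t2_c3_q4_m0 hs hline hplane hH hr (by omega) hm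
      · exact traceSum_nonneg_t2_c4_q4_m0 hs hline hplane hH hr (by omega) hm
      · exact traceSum_nonneg_t2_c5_q4_m0 hs hline hplane hH hr (by omega) hm
      · exact traceSum_nonneg_t2_c6_q4_m0 hs hline hplane hH hr (by omega) hm
    · have h7 := hsz.1 hm
      rcases (show H.card ≤ 5 ∨ H.card = 6 ∨ H.card = 7 by omega) with h0 | h1 | h2
      · exact traceSum_nonneg_of_card_le (by norm_num) (by norm_num) (by omega)
      · exact traceSum_nonneg_t2_c2_q4_m1 hs hline hplane hH hr (by omega) hm
      · exact traceSum_nonneg_t2_c3_q4_m1 hs hline hplane hH hr (by omega) hm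
    · have h5 := hsz.2.1 hm
      exact traceSum_nonneg_of_card_le (by norm_num) (by norm_num) (by omega)
    · have h4' := hsz.2.2.1 hm
      exact traceSum_nonneg_of_card_le (by norm_num) (by norm_num) (by omega)
    · have h5 := hsz.2.2.2 hm
      exact traceSum_nonneg_of_card_le (by norm_num) (by norm_num) (by omega)
  · -- `t = 3`
    rcases (show mTr M H = 0 ∨ mTr M H = 1 ∨ mTr M H = 2 ∨ mTr M H = 3 ∨ mTr M H = 4 by omega) with hm | hm | hm | hm | hm
    · rcases (show H.card ≤ 6 ∨ H.card = 7 ∨ H.card = 8 ∨ H.card = 9 ∨ H.card = 10 by omega) with h0 | h1 | h2 | h3 | h4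
      · exact traceSum_nonneg_of_card_le (by norm_num) (by norm_num) (by omega)
      · exact traceSum_nonneg_t3_c3_q4_m0 hs hline hplane hH hr (by omega) hm
      · exact traceSum_nonneg_t3_c4_q4_m0 hs hline hplane hH hr (by omega) hm
      · exact traceSum_nonneg_t3_c5_q4_m0 hs hline hplane hH hr (by omega) hm
      · exact traceSum_nonneg_t3_c6_q4_m0 hs hline hplane hH hr (by omega) hm
    · have h7 := hsz.1 hm
      rcases (show H.card ≤ 6 ∨ H.card = 7 by omega) with h0 | h1
      · exact traceSum_nonneg_of_card_le (by norm_num) (by norm_num) (by omega)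
      · exact traceSum_nonneg_t3_c3_q4_m1 hs hline hplane hH hr (by omega) hm
    · have h5 := hsz.2.1 hm
      exact traceSum_nonneg_of_card_le (by norm_num) (by norm_num) (by omega)
    · have h4' := hsz.2.2.1 hm
      exact traceSum_nonneg_of_card_le (by norm_num) (by norm_num) (by omega)
    · have h5 := hsz.2.2.2 hm
      exact traceSum_nonneg_of_card_le (by norm_num) (by norm_num) (by omega)
  · -- `t = 4`
    rcases (show mTr M H = 0 ∨ mTr M H = 1 ∨ mTr M H = 2 ∨ mTr M H = 3 ∨ mTr M H = 4 by omega) with hm | hm | hm | hm | hm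
    · rcases (show H.card ≤ 7 ∨ H.card = 8 ∨ H.card = 9 ∨ H.card = 10 by omega) with h0 | h1 | h2 | h3
      · exact traceSum_nonneg_of_card_le (by norm_num) (by norm_num) (by omega)
      · exact traceSum_nonneg_t4_c4_q4_m0 hs hline hplane hH hr (by omega) hm
      · exact traceSum_nonneg_t4_c5_q4_m0 hs hline hplane hH hr (by omega) hm
      · exact traceSum_nonneg_t4_c6_q4_m0 hs hline hplane hH hr (by omega) hm
    · have h7 := hsz.1 hm
      exact traceSum_nonneg_of_card_le (by norm_num) (by norm_num) (by omega)
    · have h5 := hsz.2.1 hm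
      exact traceSum_nonneg_of_card_le (by norm_num) (by norm_num) (by omega)
    · have h4' := hsz.2.2.1 hm
      exact traceSum_nonneg_of_card_le (by norm_num) (by norm_num) (by omega)
    · have h5 := hsz.2.2.2 hm
      exact traceSum_nonneg_of_card_le (by norm_num) (by norm_num) (by omega)

end PercRepro.Star
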